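import Mathlib.Probability.Distributions.Gaussian.Multivariate
import Mathlib.Probability.ProductMeasure
import Mathlib.Probability.Independence.InfinitePi
import Literature.Analysis.FluidPDE.HardSphereFlowMeasurable
import Literature.MathematicalPhysics.KineticTheory.HardSphereEuler
import HarnessLib

/-!
# The Lambertian (cosine-law) stochastic hard-sphere flow

Topic `Literature/MathematicalPhysics/KineticTheory` (definition item
`defn-LambertianHardSphereFlow`, wanted by the routes `SpecularLambertianSwap` and
`RandomFutureLindeberg` of `AtomisticToContinuum/HydrodynamicLimit`, where the object is written
inline, verbatim, as a `let` block in the items `SwapGap`, `LambertianEuler`, `SwapIdentity`,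
`LambertianWellPosed`).

The **Lambertian gas** is the collision-by-collision hard-sphere dynamics of
`Literature.Analysis.FluidPDE.HardSphereFlowConstruction` (`Alexander.freeExitTime`,
`Alexander.incomingPairs`: same free flight, same exit times, same colliding pairs as the
deterministic flow) in which the elastic reflection `collidePair` of the colliding pair is
replaced by a **random redraw of the outgoing relative velocity**: at the `k`-th collision, with
contact normal `ω = x_i - x_j` and incoming relative velocity `g = v_i - v_j`, the outgoing pair
velocities are `c ± (|g|/2) n_k` with `c = (v_i + v_j)/2` and
`n_k = lambertDir ω ξ_k = normalize(ω̂ + ξ̂_k)`, `ξ_k` i.i.d. standard Gaussian. Pair momentum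
and kinetic energy are conserved exactly (`configMomentum_lambertPair`,
`configEnergy_lambertPair`), and in dimension `3`, for `ξ` standard Gaussian, `n = normalize(ω̂ + ξ̂)`
has the **cosine (Lambert / Knudsen) law** `∝ (n · ω̂)₊ dn` on the outgoing hemisphere about
`ω̂` (if `ξ̂` makes the angle `θ` with `ω̂`, `cos θ` uniform on `[-1, 1]`, then `n` makes the angle
`θ/2`, whose law `sin θ dθ ∝ cos(θ/2) sin(θ/2) d(θ/2)` is the cosine law) — the reflection law of
the Knudsen stochastic billiard (Comets–Popov–Schütz–Vachkovskaia 2008, §2.1; Feres–Yablonsky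
2004), here applied to the *relative velocity of a colliding pair* rather than to one particle
at a wall.

* `lambertDir ω ξ = normalize(ω̂ + ξ̂)` (any real inner product space);
* `lambertPair G i j z ξ` — the redraw of the pair `(i, j)` (positions unchanged);
* `lambertStep G ε ξ z` — free flight up to the exit time `τ(z)`, then `lambertPair` on the
  incoming contact pair of the exit configuration (`Alexander.collisionStep` with `collidePair`
  replaced by the redraw; the identity if `τ(z) = ∞`);
* `lambertStateAfter G ε ξs z k`, `lambertInstant G ε ξs z k`, `lambertCount G ε ξs z t`,
  `lambertFlow G ε ξs z t` — the `k`-th post-collisional state of the recursion driven by the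
  noise sequence `ξs : ℕ → ℝ^d` (the `k`-th collision uses `ξs k`), the collision instants
  `t_k = ∑_{m<k} τ(z_m)`, the number of collisions in `[0, t]` and the right-continuous flow
  `S_{t - t_K} z_K`, `K = lambertCount`, literally as `Alexander.stateAfter / collisionInstant /
  collisionCount / fwdFlow`;
* `lambertNoise d = ⨂_ℕ stdGaussian(ℝ^d)` (`Measure.infinitePi`), the law of the driving sequence.

API proved here: unfolding and restart lemmas (`lambertStateAfter_succ`,
`lambertStateAfter_succ_eq_tail` — the recursion restarted after its first collision is the
recursion driven by the shifted noise —, `lambertInstant_succ_eq_tail`,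
`lambertFlow_eq_lambertFlow_lambertStep`), segment lemmas (`lambertCount_eq_of_segment`,
`lambertFlow_eq_of_segment`, `lambertFlow_eq_freeFlight_of_lt`), conservation of total momentum
and kinetic energy (`configMomentum_lambertStep`, `configEnergy_lambertStep`), the outgoing
property of the redrawn pair (`isOutgoing_lambertPair_iff`: outgoing iff `g ≠ 0` and `n` is not
orthogonal to `ω`; `inner_lambertDir_nonneg`), and **joint measurability in `(z, ξs)`** of the
step, the states, the instants, the counts and the flow for a regular measurable geometry
(`measurable_lambertFlow`), specialised to the torus and to the fixed-reduced-density diameter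
`hsDiameter σ N` (`measurable_lambertFlow_hsDiameter`, clause (a) of the route item
`LambertianWellPosed`); and for the noise: shift invariance (`lambertNoise_map_tail`),
independence of head and tail (`indepFun_head_tail_lambertNoise`), the head/tail decomposition
`γ^ℕ ≅ γ ⊗ γ^ℕ` (`lambertNoise_map_headTail`) and the resulting Fubini identity
(`integral_lambertNoise_headTail`) — the measure-theoretic input of the Trotter–Lindeberg
telescoping over the collision sequence.

## Design choices

* The bodies of the eight definitions are, up to the names of the bound variables, the `let`
  block of the route items (with `G`, `ε` general), so that the items can be restated over these
  names by `Iff.rfl` (checked on `LambertianWellPosed`). For the same reason the recursion is not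
  phrased through the extended-phase-space construction `Carrying.step/stateAfter/…` of
  `RoughSphereFlow.lean` (which iterates a *deterministic* pair rule on `Config × Y`; the noise
  sequence could be carried as `Y = ℕ → ℝ^d` and shifted at each contact): here the noise is an
  external i.i.d. sequence indexed by the collision number, exactly as the routes wrote it.
* Generality: any `Geometry d X` and dimension `d`; the cosine-law interpretation of
  `lambertDir` holds in `d = 3` only (in dimension `d` the law of `normalize(ω̂ + ξ̂)` is the
  half-angle push-forward of the uniform law, which is Lambertian exactly when `d = 3`).
* Junk values, documented: `lambertDir ω ξ = 0` when the bisector `ω̂ + ξ̂` vanishes (`ω = 0`,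
  or `ξ ≠ 0` antiparallel to `ω`, `inner_eq_neg_of_lambertDir_eq_zero` — a Gaussian-null ray);
  then the redrawn pair gets equal velocities `c, c` and kinetic energy is *not* conserved
  (`configEnergy_lambertPair` carries the non-degeneracy hypothesis, `configEnergy_lambertPair_le`
  holds always). `‖x‖⁻¹ • x = 0` at `x = 0`. `lambertCount` inherits the junk value `0` of
  `sSup` on an unbounded set of naturals (Zeno orbits), like `Alexander.collisionCount`.
* Not here (problem-side items of the routes, not literature): Liouville `⊗ lambertNoise`
  -invariance of `lambertFlow` and almost-sure well-posedness (no multiple / grazing collisions,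
  no accumulation) — the analogue of `Alexander.torusFlow_ae_good` /
  `torusFlow_measurePreserving` for the random redraw (route item `LambertianWellPosed`).

## References

* F. Comets, S. Popov, G. M. Schütz, M. Vachkovskaia, *Billiards in a general domain with random
  reflections*, Arch. Ration. Mech. Anal. 191 (2008) 497–537, §2.1 (cosine reflection law,
  Knudsen stochastic billiard), Thm. 2.4 (invariance of `μ₀ ⊗ ν₀`).
* R. Feres, G. Yablonsky, *Knudsen's cosine law and random billiards*, Chem. Eng. Sci. 59 (2004)
  1541–1556.
* C. Cercignani, R. Illner, M. Pulvirenti, *The Mathematical Theory of Dilute Gases* (1994),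
  App. 4.A (the collision-by-collision construction).
-/

noncomputable section

open MeasureTheory ProbabilityTheory Set Function Filter
open scoped ENNReal InnerProductSpace

namespace Literature.MathematicalPhysics.KineticTheory

open Literature.Analysis.FluidPDE Literature.Analysis.FluidPDE.Alexander

/-! ## The Lambertian direction `normalize(ω̂ + ξ̂)` -/

section Dir

variable {E : Type*} [NormedAddCommGroup E] [InnerProductSpace ℝ E]

/-- The **Lambertian direction** attached to a normal vector `ω` and a noise vector `ξ`:
`lambertDir ω ξ = (ω̂ + ξ̂)/|ω̂ + ξ̂|` with `x̂ = x/|x|`, the unit bisector of the directions of `ω`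
and `ξ`. For `ξ` standard Gaussian in `ℝ³` (so `ξ̂` uniform on the sphere) its law is the cosine
(Lambert, Knudsen) law `∝ (n · ω̂)₊ dn` on the hemisphere `{n · ω > 0}` — the reflection law of
the Knudsen stochastic billiard. Junk value `0` when `ω̂ + ξ̂ = 0`.
[cite: CometsEtAl2008, §2.1] -/
def lambertDir (ω ξ : E) : E :=
  ‖‖ω‖⁻¹ • ω + ‖ξ‖⁻¹ • ξ‖⁻¹ • (‖ω‖⁻¹ • ω + ‖ξ‖⁻¹ • ξ)

/-- Unfolding lemma for `lambertDir`. [folklore] -/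
theorem lambertDir_def (ω ξ : E) :
    lambertDir ω ξ = ‖‖ω‖⁻¹ • ω + ‖ξ‖⁻¹ • ξ‖⁻¹ • (‖ω‖⁻¹ • ω + ‖ξ‖⁻¹ • ξ) := rfl

/-- The Lambertian direction vanishes exactly when the bisector `ω̂ + ξ̂` does (the documented
junk case). [folklore] -/
theorem lambertDir_eq_zero_iff {ω ξ : E} :
    lambertDir ω ξ = 0 ↔ ‖ω‖⁻¹ • ω + ‖ξ‖⁻¹ • ξ = 0 := by
  rw [lambertDir, smul_eq_zero, inv_eq_zero, norm_eq_zero, or_self]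

/-- Off the junk case the Lambertian direction is a unit vector. [folklore] -/
theorem norm_lambertDir {ω ξ : E} (h : lambertDir ω ξ ≠ 0) : ‖lambertDir ω ξ‖ = 1 := by
  rw [Ne, lambertDir_eq_zero_iff] at h
  rw [lambertDir, norm_smul, norm_inv, norm_norm, inv_mul_cancel₀ (norm_ne_zero_iff.2 h)]

/-- `|lambertDir ω ξ| ≤ 1` always (it is `1` or, in the junk case, `0`). [folklore] -/
theorem norm_lambertDir_le_one (ω ξ : E) : ‖lambertDir ω ξ‖ ≤ 1 := by
  by_cases h : lambertDir ω ξ = 0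
  · rw [h, norm_zero]; exact zero_le_one
  · exact (norm_lambertDir h).le

/-- The bisector `ω̂ + ξ̂` lies in the closed half-space of `ω`:
`⟪ω, ω̂ + ξ̂⟫ = |ω| + ⟪ω, ξ⟫/|ξ| ≥ 0` (Cauchy–Schwarz). [folklore] -/
theorem inner_bisector_nonneg (ω ξ : E) : 0 ≤ ⟪ω, ‖ω‖⁻¹ • ω + ‖ξ‖⁻¹ • ξ⟫_ℝ := by
  have hξ : ‖ξ‖⁻¹ * ‖ξ‖ ≤ 1 := by
    by_cases h : ‖ξ‖ = 0
    · simp [h]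
    · rw [inv_mul_cancel₀ h]
  have hω : ‖ω‖⁻¹ * ‖ω‖ ^ 2 = ‖ω‖ := by
    by_cases h : ‖ω‖ = 0
    · simp [h]
    · field_simp
  have hinner : -(‖ω‖ * ‖ξ‖) ≤ ⟪ω, ξ⟫_ℝ := neg_le_of_abs_le (abs_real_inner_le_norm ω ξ)
  rw [inner_add_right, inner_smul_right, inner_smul_right, real_inner_self_eq_norm_sq, hω]
  have h1 : ‖ω‖ * (‖ξ‖⁻¹ * ‖ξ‖) ≤ ‖ω‖ := by
    simpa using mul_le_mul_of_nonneg_left hξ (norm_nonneg ω)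
  have h2 : ‖ξ‖⁻¹ * -(‖ω‖ * ‖ξ‖) ≤ ‖ξ‖⁻¹ * ⟪ω, ξ⟫_ℝ :=
    mul_le_mul_of_nonneg_left hinner (inv_nonneg.2 (norm_nonneg ξ))
  have h3 : ‖ξ‖⁻¹ * -(‖ω‖ * ‖ξ‖) = -(‖ω‖ * (‖ξ‖⁻¹ * ‖ξ‖)) := by ring
  linarith

/-- The redrawn direction never points into the obstacle: `⟪ω, lambertDir ω ξ⟫ ≥ 0`. [folklore] -/
theorem inner_lambertDir_nonneg (ω ξ : E) : 0 ≤ ⟪ω, lambertDir ω ξ⟫_ℝ := by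
  rw [lambertDir, inner_smul_right]
  exact mul_nonneg (inv_nonneg.2 (norm_nonneg _)) (inner_bisector_nonneg ω ξ)

/-- The junk case, located: if `ω ≠ 0` and `lambertDir ω ξ = 0` then `ξ` is antiparallel to
`ω`, `⟪ω, ξ⟫ = -|ω| |ξ|` (for `ξ` Gaussian, a null event). [folklore] -/
theorem inner_eq_neg_of_lambertDir_eq_zero {ω ξ : E} (hω : ω ≠ 0) (h : lambertDir ω ξ = 0) :
    ⟪ω, ξ⟫_ℝ = -(‖ω‖ * ‖ξ‖) := by
  rw [lambertDir_eq_zero_iff] at h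
  have hω' : ‖ω‖ ≠ 0 := norm_ne_zero_iff.2 hω
  have h1 : ⟪ω, ‖ω‖⁻¹ • ω + ‖ξ‖⁻¹ • ξ⟫_ℝ = 0 := by rw [h, inner_zero_right]
  rw [inner_add_right, inner_smul_right, inner_smul_right, real_inner_self_eq_norm_sq] at h1
  have e1 : ‖ω‖⁻¹ * ‖ω‖ ^ 2 = ‖ω‖ := by field_simp
  rw [e1] at h1
  by_cases hξ : ξ = 0
  · subst hξ
    simp
  · have hξ' : ‖ξ‖ ≠ 0 := norm_ne_zero_iff.2 hξ
    have h2 : ‖ξ‖ * (‖ω‖ + ‖ξ‖⁻¹ * ⟪ω, ξ⟫_ℝ) = 0 := by rw [h1, mul_zero]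
    rw [mul_add, ← mul_assoc, mul_inv_cancel₀ hξ', one_mul] at h2
    linarith

/-- Contrapositive form: away from the antiparallel ray the Lambertian direction is a genuine
(unit) direction. [folklore] -/
theorem lambertDir_ne_zero {ω ξ : E} (hω : ω ≠ 0) (h : ⟪ω, ξ⟫_ℝ ≠ -(‖ω‖ * ‖ξ‖)) :
    lambertDir ω ξ ≠ 0 := fun h0 => h (inner_eq_neg_of_lambertDir_eq_zero hω h0)

/-- The Lambertian direction is positively homogeneous of degree `0` in `ω`: it only depends on
the direction `ω̂`. [folklore] -/
theorem lambertDir_smul_left {c : ℝ} (hc : 0 < c) (ω ξ : E) :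
    lambertDir (c • ω) ξ = lambertDir ω ξ := by
  have h : ‖c • ω‖⁻¹ • (c • ω) = ‖ω‖⁻¹ • ω := by
    by_cases hω : ω = 0
    · simp [hω]
    · rw [norm_smul, Real.norm_of_nonneg hc.le, smul_smul, mul_inv, mul_right_comm,
        inv_mul_cancel₀ hc.ne', one_mul]
  rw [lambertDir, lambertDir, h]

end Dir

/-! ## The Lambertian redraw of a colliding pair -/

section Pair

variable {d : Type*} [Fintype d] {X : Type*} {N : ℕ}

/-- The **Lambertian redraw** of the pair `(i, j)` in the configuration `z` with noise `ξ`: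
positions are unchanged and the velocities become `v_i' = c + w`, `v_j' = c - w` with
`c = (v_i + v_j)/2` and `w = (|v_i - v_j|/2) · lambertDir (x_i - x_j) ξ` — the outgoing relative
velocity is `|g| n` with `n` the Lambertian direction about the contact normal, so that pair
momentum and kinetic energy are conserved (`configMomentum_lambertPair`,
`configEnergy_lambertPair`). This is the random-reflection analogue, for a pair, of the elastic
`Literature.Analysis.FluidPDE.collidePair`. Only meaningful for `i ≠ j`. [cite: CometsEtAl2008, §2.1] -/
def lambertPair (G : Geometry d X) (i j : Fin N) (z : Config N d X) (ξ : EuclideanSpace ℝ d) :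
    Config N d X :=
  let c := (2 : ℝ)⁻¹ • ((z i).2 + (z j).2)
  let w := (‖(z i).2 - (z j).2‖ / 2) • lambertDir (G.sepVec (z i).1 (z j).1) ξ
  Function.update (Function.update z i ((z i).1, c + w)) j ((z j).1, c - w)

variable {G : Geometry d X} {i j : Fin N}

/-- After the redraw, particle `j` has velocity `c - w` and unchanged position. [folklore] -/
theorem lambertPair_apply_right (z : Config N d X) (ξ : EuclideanSpace ℝ d) :
    lambertPair G i j z ξ j = ((z j).1, (2 : ℝ)⁻¹ • ((z i).2 + (z j).2) -
      (‖(z i).2 - (z j).2‖ / 2) • lambertDir (G.sepVec (z i).1 (z j).1) ξ) := by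
  simp [lambertPair]

/-- After the redraw, particle `i` has velocity `c + w` and unchanged position. [folklore] -/
theorem lambertPair_apply_left (hij : i ≠ j) (z : Config N d X) (ξ : EuclideanSpace ℝ d) :
    lambertPair G i j z ξ i = ((z i).1, (2 : ℝ)⁻¹ • ((z i).2 + (z j).2) +
      (‖(z i).2 - (z j).2‖ / 2) • lambertDir (G.sepVec (z i).1 (z j).1) ξ) := by
  simp [lambertPair, Function.update_of_ne hij]

/-- Particles other than `i, j` are unaffected by the redraw of `(i, j)`. [folklore] -/
theorem lambertPair_apply_of_ne {k : Fin N} (hki : k ≠ i) (hkj : k ≠ j) (z : Config N d X)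
    (ξ : EuclideanSpace ℝ d) : lambertPair G i j z ξ k = z k := by
  simp [lambertPair, Function.update_of_ne hki, Function.update_of_ne hkj]

/-- The redraw does not move the particles. [folklore] -/
@[simp]
theorem lambertPair_apply_fst (z : Config N d X) (ξ : EuclideanSpace ℝ d) (k : Fin N) :
    (lambertPair G i j z ξ k).1 = (z k).1 := by
  by_cases hkj : k = j
  · subst hkj; rw [lambertPair_apply_right]
  by_cases hki : k = i
  · subst hki; rw [lambertPair_apply_left hkj]
  rw [lambertPair_apply_of_ne hki hkj]

/-- The redraw preserves the hard-sphere domain (positions are unchanged). [folklore] -/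
theorem lambertPair_mem_hardSphereDomain_iff {ε : ℝ} (z : Config N d X) (ξ : EuclideanSpace ℝ d) :
    lambertPair G i j z ξ ∈ hardSphereDomain G N ε ↔ z ∈ hardSphereDomain G N ε := by
  simp [mem_hardSphereDomain]

/-- The redraw preserves each contact set (positions are unchanged). [folklore] -/
theorem lambertPair_mem_contactSet_iff {ε : ℝ} {a b : Fin N} (z : Config N d X)
    (ξ : EuclideanSpace ℝ d) :
    lambertPair G i j z ξ ∈ contactSet G N ε a b ↔ z ∈ contactSet G N ε a b := by
  simp [mem_contactSet, mem_hardSphereDomain]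

/-- The outgoing relative velocity of the redrawn pair is `|g| · lambertDir ω ξ`. [folklore] -/
theorem vel_sub_vel_lambertPair (hij : i ≠ j) (z : Config N d X) (ξ : EuclideanSpace ℝ d) :
    (lambertPair G i j z ξ i).2 - (lambertPair G i j z ξ j).2 =
      ‖(z i).2 - (z j).2‖ • lambertDir (G.sepVec (z i).1 (z j).1) ξ := by
  rw [lambertPair_apply_left hij, lambertPair_apply_right]
  dsimp only
  rw [add_sub_sub_cancel, ← add_smul, add_halves]

/-- Off the junk case the redraw preserves the relative speed: `|v_i' - v_j'| = |v_i - v_j|`.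
[folklore] -/
theorem norm_vel_sub_vel_lambertPair (hij : i ≠ j) (z : Config N d X) (ξ : EuclideanSpace ℝ d)
    (h : lambertDir (G.sepVec (z i).1 (z j).1) ξ ≠ 0) :
    ‖(lambertPair G i j z ξ i).2 - (lambertPair G i j z ξ j).2‖ = ‖(z i).2 - (z j).2‖ := by
  rw [vel_sub_vel_lambertPair hij, norm_smul, norm_norm, norm_lambertDir h, mul_one]

/-- A sum over `Fin N` is unchanged if the summand changes only at `i ≠ j` with the same
two-term sum there. [folklore] -/
private theorem sum_eq_sum_of_pair {M : Type*} [AddCommMonoid M] (hij : i ≠ j) {f g : Fin N → M}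
    (hfg : f i + f j = g i + g j) (h : ∀ k, k ≠ i → k ≠ j → f k = g k) :
    ∑ k, f k = ∑ k, g k := by
  have hj : j ∈ Finset.univ.erase i := Finset.mem_erase.2 ⟨hij.symm, Finset.mem_univ j⟩
  rw [← Finset.add_sum_erase _ _ (Finset.mem_univ i), ← Finset.add_sum_erase _ _ hj,
    ← Finset.add_sum_erase _ _ (Finset.mem_univ i), ← Finset.add_sum_erase _ _ hj,
    ← add_assoc, ← add_assoc, hfg]
  congr 1
  refine Finset.sum_congr rfl fun k hk => ?_
  simp only [Finset.mem_erase] at hk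
  exact h k hk.2.1 hk.1

/-- **The Lambertian redraw conserves the total momentum**: `v_i' + v_j' = 2c = v_i + v_j`.
[folklore] -/
theorem configMomentum_lambertPair (hij : i ≠ j) (z : Config N d X) (ξ : EuclideanSpace ℝ d) :
    configMomentum (lambertPair G i j z ξ) = configMomentum z := by
  unfold configMomentum
  refine sum_eq_sum_of_pair hij ?_ fun k hki hkj => by rw [lambertPair_apply_of_ne hki hkj]
  rw [lambertPair_apply_left hij, lambertPair_apply_right]
  dsimp only
  rw [add_add_sub_cancel, ← two_smul ℝ, smul_smul, mul_inv_cancel₀ two_ne_zero, one_smul]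

/-- **The Lambertian redraw conserves the kinetic energy** off the junk case (unit redrawn
direction, or zero relative velocity): `|c + w|² + |c - w|² = 2|c|² + 2|w|² = |v_i|² + |v_j|²`
since `|w| = |v_i - v_j|/2`. [folklore] -/
theorem configEnergy_lambertPair (hij : i ≠ j) (z : Config N d X) (ξ : EuclideanSpace ℝ d)
    (h : lambertDir (G.sepVec (z i).1 (z j).1) ξ ≠ 0 ∨ (z i).2 = (z j).2) :
    configEnergy (lambertPair G i j z ξ) = configEnergy z := by
  unfold configEnergy
  congr 1
  refine sum_eq_sum_of_pair hij ?_ fun k hki hkj => by rw [lambertPair_apply_of_ne hki hkj]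
  rw [lambertPair_apply_left hij, lambertPair_apply_right]
  dsimp only
  set vi := (z i).2
  set vj := (z j).2
  set c := (2 : ℝ)⁻¹ • (vi + vj) with hc_def
  set w := (‖vi - vj‖ / 2) • lambertDir (G.sepVec (z i).1 (z j).1) ξ with hw_def
  have hw : ‖w‖ ^ 2 = (‖vi - vj‖ / 2) ^ 2 := by
    rcases h with h | h
    · rw [hw_def, norm_smul, norm_lambertDir h, mul_one, Real.norm_of_nonneg (by positivity)]
    · have : vi - vj = 0 := sub_eq_zero.2 h
      rw [hw_def, this, norm_zero, zero_div, zero_smul, norm_zero]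
  have hc : ‖c‖ ^ 2 = (‖vi + vj‖ / 2) ^ 2 := by
    rw [hc_def, norm_smul, norm_inv, Real.norm_two]
    ring
  have h1 := norm_add_sq_real c w
  have h2 := norm_sub_sq_real c w
  have h3 := parallelogram_law_with_norm ℝ vi vj
  linear_combination h1 + h2 + 2 * hc + 2 * hw + (1 / 2 : ℝ) * h3

/-- The Lambertian redraw never increases the kinetic energy (in the junk case the relative
kinetic energy of the pair is lost). [folklore] -/
theorem configEnergy_lambertPair_le (hij : i ≠ j) (z : Config N d X) (ξ : EuclideanSpace ℝ d) :
    configEnergy (lambertPair G i j z ξ) ≤ configEnergy z := by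
  by_cases h : lambertDir (G.sepVec (z i).1 (z j).1) ξ ≠ 0 ∨ (z i).2 = (z j).2
  · exact (configEnergy_lambertPair hij z ξ h).le
  rw [not_or, not_ne_iff] at h
  obtain ⟨h0, -⟩ := h
  unfold configEnergy
  refine mul_le_mul_of_nonneg_left ?_ (by norm_num)
  have hj : j ∈ Finset.univ.erase i := Finset.mem_erase.2 ⟨hij.symm, Finset.mem_univ j⟩
  rw [← Finset.add_sum_erase _ _ (Finset.mem_univ i), ← Finset.add_sum_erase _ _ hj,
    ← Finset.add_sum_erase _ _ (Finset.mem_univ i), ← Finset.add_sum_erase _ _ hj,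
    ← add_assoc, ← add_assoc]
  have hrest : ∑ k ∈ (Finset.univ.erase i).erase j, ‖(lambertPair G i j z ξ k).2‖ ^ 2 =
      ∑ k ∈ (Finset.univ.erase i).erase j, ‖(z k).2‖ ^ 2 := by
    refine Finset.sum_congr rfl fun k hk => ?_
    simp only [Finset.mem_erase] at hk
    rw [lambertPair_apply_of_ne hk.2.1 hk.1]
  rw [hrest, add_le_add_iff_right, lambertPair_apply_left hij, lambertPair_apply_right]
  dsimp only
  rw [h0, smul_zero, add_zero, sub_zero]
  set vi := (z i).2
  set vj := (z j).2
  have hc : ‖(2 : ℝ)⁻¹ • (vi + vj)‖ ^ 2 = (‖vi + vj‖ / 2) ^ 2 := by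
    rw [norm_smul, norm_inv, Real.norm_two]
    ring
  have h3 := parallelogram_law_with_norm ℝ vi vj
  nlinarith [hc, h3, norm_nonneg (vi - vj), sq_nonneg ‖vi - vj‖]

/-- **The redrawn pair is outgoing iff the relative velocity is nonzero and the redrawn
direction is not orthogonal to the contact normal** (then `⟪ω, v_i' - v_j'⟫ = |g| ⟪ω, n⟫ > 0` by
`inner_lambertDir_nonneg`). [folklore] -/
theorem isOutgoing_lambertPair_iff (hij : i ≠ j) (z : Config N d X) (ξ : EuclideanSpace ℝ d) :
    IsOutgoing G (lambertPair G i j z ξ) i j ↔ (z i).2 ≠ (z j).2 ∧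
      ⟪G.sepVec (z i).1 (z j).1, lambertDir (G.sepVec (z i).1 (z j).1) ξ⟫_ℝ ≠ 0 := by
  unfold IsOutgoing
  rw [lambertPair_apply_fst, lambertPair_apply_fst, vel_sub_vel_lambertPair hij,
    inner_smul_right]
  have hn := inner_lambertDir_nonneg (G.sepVec (z i).1 (z j).1) ξ
  constructor
  · intro h
    refine ⟨fun heq => ?_, fun h0 => ?_⟩
    · rw [heq, sub_self, norm_zero, zero_mul] at h
      exact lt_irrefl _ h
    · rw [h0, mul_zero] at h
      exact lt_irrefl _ h
  · rintro ⟨hv, h0⟩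
    exact mul_pos (norm_pos_iff.2 (sub_ne_zero.2 hv)) (lt_of_le_of_ne hn (Ne.symm h0))

/-- In particular the redrawn pair is outgoing whenever the relative velocity is nonzero and
the redrawn direction is not orthogonal to the contact normal. [folklore] -/
theorem isOutgoing_lambertPair (hij : i ≠ j) {z : Config N d X} {ξ : EuclideanSpace ℝ d}
    (hv : (z i).2 ≠ (z j).2)
    (h : ⟪G.sepVec (z i).1 (z j).1, lambertDir (G.sepVec (z i).1 (z j).1) ξ⟫_ℝ ≠ 0) :
    IsOutgoing G (lambertPair G i j z ξ) i j :=
  (isOutgoing_lambertPair_iff hij z ξ).2 ⟨hv, h⟩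

end Pair

/-! ## One Lambertian collision step, and the flow driven by a noise sequence -/

section Flow

variable {d : Type*} [Fintype d] {X : Type*} {N : ℕ}

variable (G : Geometry d X) (ε : ℝ)

open Classical in
/-- **One step of the Lambertian hard-sphere dynamics** with noise `ξ`: free flight for the exit
time `τ(z)` (`Alexander.freeExitTime`), then the Lambertian redraw `lambertPair` of an incoming
contact pair of the configuration reached (`Alexander.incomingPairs`, `Set.Nonempty.some`; on
simple incoming collision configurations no choice is made). The identity if `τ(z) = ∞`; no
redraw if no incoming contact pair is present at the exit configuration. This is
`Alexander.collisionStep` with the elastic `collidePair` replaced by the random redraw.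
[cite: CIP1994, App. 4.A p. 111] -/
def lambertStep (ξ : EuclideanSpace ℝ d) (z : Config N d X) : Config N d X :=
  let z' := freeFlight G (freeExitTime G ε z).toReal z
  if freeExitTime G ε z = ∞ then z
  else if h : (incomingPairs G ε z').Nonempty then lambertPair G h.some.1 h.some.2 z' ξ else z'

/-- The `k`-th post-collisional state of the **Lambertian recursion driven by the noise sequence
`ξs`**: iterate `(z, n) ↦ (lambertStep (ξs n) z, n + 1)` `k` times from `(z, 0)` and keep the
configuration — the `k`-th collision is redrawn with `ξs k` (`lambertStateAfter_succ`).
Analogue of `Alexander.stateAfter`. [cite: CIP1994, App. 4.A p. 109] -/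
def lambertStateAfter (ξs : ℕ → EuclideanSpace ℝ d) (z : Config N d X) (k : ℕ) : Config N d X :=
  ((fun p : Config N d X × ℕ => (lambertStep G ε (ξs p.2) p.1, p.2 + 1))^[k] (z, 0)).1

/-- The `k`-th collision instant `t_k = ∑_{m<k} τ(z_m) ∈ [0, ∞]` of the Lambertian recursion
(`t_0 = 0`). Analogue of `Alexander.collisionInstant`. [cite: CIP1994, App. 4.A p. 109] -/
def lambertInstant (ξs : ℕ → EuclideanSpace ℝ d) (z : Config N d X) (k : ℕ) : ℝ≥0∞ :=
  ∑ m ∈ Finset.range k, freeExitTime G ε (lambertStateAfter G ε ξs z m)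

/-- The number of collisions of the Lambertian recursion in `[0, t]`: the largest `k` with
`t_k ≤ t` (junk value `0` if the instants accumulate before `t`). Analogue of
`Alexander.collisionCount`. [folklore] -/
def lambertCount (ξs : ℕ → EuclideanSpace ℝ d) (z : Config N d X) (t : ℝ) : ℕ :=
  sSup {k : ℕ | lambertInstant G ε ξs z k ≤ ENNReal.ofReal t}

/-- **The Lambertian hard-sphere flow** driven by the noise sequence `ξs`:
`Λ_t(z, ξs) = S_{t - t_K} z_K`, `K = lambertCount` — free flight from the last post-collisional
state (right-continuous in `t`). Analogue of `Alexander.fwdFlow`; meaningful for `t ≥ 0` and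
almost every `(z, ξs)`. [cite: CIP1994, §4.2 p. 65] -/
def lambertFlow (ξs : ℕ → EuclideanSpace ℝ d) (z : Config N d X) (t : ℝ) : Config N d X :=
  freeFlight G (t - (lambertInstant G ε ξs z (lambertCount G ε ξs z t)).toReal)
    (lambertStateAfter G ε ξs z (lambertCount G ε ξs z t))

/-- **The Lambertian noise**: the law `⨂_{k ∈ ℕ} N(0, I_d)` of an i.i.d. sequence of standard
Gaussian vectors of `ℝ^d` (`Measure.infinitePi` of `ProbabilityTheory.stdGaussian`), driving the
redraws. [folklore] -/
def lambertNoise (d : Type*) [Fintype d] : Measure (ℕ → EuclideanSpace ℝ d) :=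
  Measure.infinitePi (fun _ : ℕ => stdGaussian (EuclideanSpace ℝ d))

/-- The Lambertian noise is a probability measure. [folklore] -/
instance isProbabilityMeasure_lambertNoise (d : Type*) [Fintype d] :
    IsProbabilityMeasure (lambertNoise d) := by
  unfold lambertNoise
  infer_instance

variable {G ε}

/-! ### The step -/

open Classical in
/-- The redraw made by the Lambertian step as a function of the *set* of incoming pairs: redraw
the pair `S.some` if `S` is nonempty (analogue of `Alexander.stepMap`; exhibits `lambertStep`
as a finite combination of measurable maps, `lambertStep_eq`). [folklore] -/
def lambertStepMap (G : Geometry d X) (S : Set (Fin N × Fin N)) (w : Config N d X)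
    (ξ : EuclideanSpace ℝ d) : Config N d X :=
  if h : S.Nonempty then lambertPair G h.some.1 h.some.2 w ξ else w

/-- The Lambertian step through `lambertStepMap`. [folklore] -/
theorem lambertStep_eq (ξ : EuclideanSpace ℝ d) (z : Config N d X) :
    lambertStep G ε ξ z = if freeExitTime G ε z = ∞ then z else
      lambertStepMap G (incomingPairs G ε (freeFlight G (freeExitTime G ε z).toReal z))
        (freeFlight G (freeExitTime G ε z).toReal z) ξ := by
  unfold lambertStep lambertStepMap
  congr

/-- If the free flight never leaves the domain, the Lambertian step is the identity. [folklore] -/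
theorem lambertStep_of_eq_top {ξ : EuclideanSpace ℝ d} {z : Config N d X}
    (h : freeExitTime G ε z = ∞) : lambertStep G ε ξ z = z := by
  rw [lambertStep_eq, if_pos h]

/-- If the free flight leaves the domain, the Lambertian step is the redraw at the exit
configuration. [folklore] -/
theorem lambertStep_of_ne_top {ξ : EuclideanSpace ℝ d} {z : Config N d X}
    (h : freeExitTime G ε z ≠ ∞) : lambertStep G ε ξ z =
      lambertStepMap G (incomingPairs G ε (freeFlight G (freeExitTime G ε z).toReal z))
        (freeFlight G (freeExitTime G ε z).toReal z) ξ := by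
  rw [lambertStep_eq, if_neg h]

/-- For a singleton set of pairs `lambertStepMap` redraws that pair. [folklore] -/
theorem lambertStepMap_singleton (p : Fin N × Fin N) (w : Config N d X) (ξ : EuclideanSpace ℝ d) :
    lambertStepMap G {p} w ξ = lambertPair G p.1 p.2 w ξ := by
  have h : ({p} : Set (Fin N × Fin N)).Nonempty := singleton_nonempty p
  rw [lambertStepMap, dif_pos h, mem_singleton_iff.1 h.some_mem]

/-- For the empty set of pairs `lambertStepMap` does nothing. [folklore] -/
theorem lambertStepMap_empty (w : Config N d X) (ξ : EuclideanSpace ℝ d) :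
    lambertStepMap G (∅ : Set (Fin N × Fin N)) w ξ = w := by
  rw [lambertStepMap, dif_neg Set.not_nonempty_empty]

/-- **On a simple incoming exit configuration the step redraws its colliding pair**: if
`τ(z) < ∞` and the incoming pairs of `z' = S_{τ(z)} z` are exactly `{p}`, then
`lambertStep ξ z = lambertPair p z' ξ`. [folklore] -/
theorem lambertStep_eq_lambertPair {ξ : EuclideanSpace ℝ d} {z : Config N d X}
    (hτ : freeExitTime G ε z ≠ ∞) {p : Fin N × Fin N}
    (hp : incomingPairs G ε (freeFlight G (freeExitTime G ε z).toReal z) = {p}) :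
    lambertStep G ε ξ z = lambertPair G p.1 p.2 (freeFlight G (freeExitTime G ε z).toReal z) ξ := by
  rw [lambertStep_of_ne_top hτ, hp, lambertStepMap_singleton]

/-- `lambertStepMap` does not move the particles. [folklore] -/
@[simp]
theorem lambertStepMap_apply_fst (S : Set (Fin N × Fin N)) (w : Config N d X)
    (ξ : EuclideanSpace ℝ d) (k : Fin N) : (lambertStepMap G S w ξ k).1 = (w k).1 := by
  unfold lambertStepMap
  split_ifs
  · exact lambertPair_apply_fst w ξ k
  · rfl

/-- `lambertStepMap G (incomingPairs w) w ξ` conserves the total momentum (the redrawn pair is an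
ordered pair `i < j`). [folklore] -/
theorem configMomentum_lambertStepMap_incomingPairs (w : Config N d X) (ξ : EuclideanSpace ℝ d) :
    configMomentum (lambertStepMap G (incomingPairs G ε w) w ξ) = configMomentum w := by
  unfold lambertStepMap
  split_ifs with h
  · exact configMomentum_lambertPair (ne_of_lt (mem_incomingPairs.1 h.some_mem).1) w ξ
  · rfl

/-- **The Lambertian step conserves the total momentum.** [folklore] -/
theorem configMomentum_lambertStep (ξ : EuclideanSpace ℝ d) (z : Config N d X) :
    configMomentum (lambertStep G ε ξ z) = configMomentum z := by
  rw [lambertStep_eq]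
  split_ifs
  · rfl
  · rw [configMomentum_lambertStepMap_incomingPairs, configMomentum_freeFlight]

/-- The Lambertian step never increases the kinetic energy. [folklore] -/
theorem configEnergy_lambertStep_le (ξ : EuclideanSpace ℝ d) (z : Config N d X) :
    configEnergy (lambertStep G ε ξ z) ≤ configEnergy z := by
  rw [lambertStep_eq]
  split_ifs with h
  · exact le_rfl
  · unfold lambertStepMap
    split_ifs with hne
    · exact (configEnergy_lambertPair_le (ne_of_lt (mem_incomingPairs.1 hne.some_mem).1) _ ξ).trans
        (configEnergy_freeFlight G _ z).le
    · exact (configEnergy_freeFlight G _ z).le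

/-- **The Lambertian step conserves the kinetic energy** as soon as the noise is non-degenerate
for every incoming contact pair of the exit configuration (an almost sure event for Gaussian
noise, `inner_eq_neg_of_lambertDir_eq_zero`). [folklore] -/
theorem configEnergy_lambertStep (ξ : EuclideanSpace ℝ d) (z : Config N d X)
    (h : ∀ p ∈ incomingPairs G ε (freeFlight G (freeExitTime G ε z).toReal z),
      lambertDir (G.sepVec (freeFlight G (freeExitTime G ε z).toReal z p.1).1
        (freeFlight G (freeExitTime G ε z).toReal z p.2).1) ξ ≠ 0) :
    configEnergy (lambertStep G ε ξ z) = configEnergy z := by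
  rw [lambertStep_eq]
  split_ifs with hτ
  · rfl
  · unfold lambertStepMap
    split_ifs with hne
    · rw [configEnergy_lambertPair (ne_of_lt (mem_incomingPairs.1 hne.some_mem).1) _ ξ
        (Or.inl (h _ hne.some_mem)), configEnergy_freeFlight]
    · exact configEnergy_freeFlight G _ z

/-- The Lambertian step preserves the hard-sphere domain (regular geometry: the exit
configuration lies in the closed domain). [folklore] -/
theorem lambertStep_mem [TopologicalSpace X] (hG : G.IsHardSphereRegular ε) (ξ : EuclideanSpace ℝ d)
    {z : Config N d X} (hz : z ∈ hardSphereDomain G N ε) :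
    lambertStep G ε ξ z ∈ hardSphereDomain G N ε := by
  by_cases hτ : freeExitTime G ε z = ∞
  · rwa [lambertStep_of_eq_top hτ]
  · have hmem := freeFlight_freeExitTime_mem hG hz hτ
    rw [lambertStep_of_ne_top hτ]
    unfold lambertStepMap
    split_ifs
    · exact (lambertPair_mem_hardSphereDomain_iff _ ξ).2 hmem
    · exact hmem

/-! ### The recursion: states and instants -/

/-- The counter of the driven recursion: after `k` iterations from `(z, n)` it reads `n + k`.
[folklore] -/
theorem iterate_lambert_snd (ξs : ℕ → EuclideanSpace ℝ d) (z : Config N d X) (n k : ℕ) :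
    ((fun p : Config N d X × ℕ => (lambertStep G ε (ξs p.2) p.1, p.2 + 1))^[k] (z, n)).2 =
      n + k := by
  induction k with
  | zero => rfl
  | succ k ih => rw [iterate_succ_apply', ih]; rfl

/-- `z_0 = z`. [folklore] -/
@[simp]
theorem lambertStateAfter_zero (ξs : ℕ → EuclideanSpace ℝ d) (z : Config N d X) :
    lambertStateAfter G ε ξs z 0 = z := rfl

/-- `z_{k+1} = lambertStep (ξs k) z_k`: the `k`-th collision is redrawn with the `k`-th noise.
[folklore] -/
theorem lambertStateAfter_succ (ξs : ℕ → EuclideanSpace ℝ d) (z : Config N d X) (k : ℕ) :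
    lambertStateAfter G ε ξs z (k + 1) = lambertStep G ε (ξs k) (lambertStateAfter G ε ξs z k) := by
  rw [lambertStateAfter, lambertStateAfter, iterate_succ_apply', iterate_lambert_snd, zero_add]

/-- `z_1 = lambertStep (ξs 0) z`. [folklore] -/
theorem lambertStateAfter_one (ξs : ℕ → EuclideanSpace ℝ d) (z : Config N d X) :
    lambertStateAfter G ε ξs z 1 = lambertStep G ε (ξs 0) z := by
  rw [lambertStateAfter_succ, lambertStateAfter_zero]

/-- The driven recursion started with counter `n` is the recursion driven by the noise shifted
by `n`. [folklore] -/
theorem iterate_lambert_fst (ξs : ℕ → EuclideanSpace ℝ d) (z : Config N d X) (n k : ℕ) :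
    ((fun p : Config N d X × ℕ => (lambertStep G ε (ξs p.2) p.1, p.2 + 1))^[k] (z, n)).1 =
      lambertStateAfter G ε (fun m => ξs (m + n)) z k := by
  induction k with
  | zero => rfl
  | succ k ih =>
    rw [iterate_succ_apply', lambertStateAfter_succ, ← ih, iterate_lambert_snd, add_comm n k]

/-- **Restart after the first collision**: the recursion driven by `ξs` from `z`, read from its
first collision on, is the recursion driven by the shifted noise `k ↦ ξs (k+1)` from
`lambertStep (ξs 0) z` (`lstate (ξ₀ :: ξ') z (k+1) = lstate ξ' (lstep ξ₀ z) k`). [folklore] -/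
theorem lambertStateAfter_succ_eq_tail (ξs : ℕ → EuclideanSpace ℝ d) (z : Config N d X) (k : ℕ) :
    lambertStateAfter G ε ξs z (k + 1) =
      lambertStateAfter G ε (fun m => ξs (m + 1)) (lambertStep G ε (ξs 0) z) k := by
  rw [lambertStateAfter, iterate_succ_apply]
  exact iterate_lambert_fst ξs (lambertStep G ε (ξs 0) z) 1 k

/-- **Restart after `k` collisions**: `z_{k+m}` is the `m`-th state of the recursion driven by
the noise shifted by `k`, started at `z_k`. [folklore] -/
theorem lambertStateAfter_add (ξs : ℕ → EuclideanSpace ℝ d) (z : Config N d X) (k m : ℕ) :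
    lambertStateAfter G ε ξs z (k + m) =
      lambertStateAfter G ε (fun n => ξs (n + k)) (lambertStateAfter G ε ξs z k) m := by
  have hk : (fun p : Config N d X × ℕ => (lambertStep G ε (ξs p.2) p.1, p.2 + 1))^[k] (z, 0) =
      (lambertStateAfter G ε ξs z k, k) :=
    Prod.ext (by rw [iterate_lambert_fst]; rfl) (by rw [iterate_lambert_snd, zero_add])
  conv_lhs => rw [lambertStateAfter, add_comm, iterate_add_apply, hk]
  exact iterate_lambert_fst ξs _ k m

/-- `t_0 = 0`. [folklore] -/
@[simp]
theorem lambertInstant_zero (ξs : ℕ → EuclideanSpace ℝ d) (z : Config N d X) :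
    lambertInstant G ε ξs z 0 = 0 := by
  simp [lambertInstant]

/-- `t_{k+1} = t_k + τ(z_k)`. [folklore] -/
theorem lambertInstant_succ (ξs : ℕ → EuclideanSpace ℝ d) (z : Config N d X) (k : ℕ) :
    lambertInstant G ε ξs z (k + 1) =
      lambertInstant G ε ξs z k + freeExitTime G ε (lambertStateAfter G ε ξs z k) := by
  rw [lambertInstant, lambertInstant, Finset.sum_range_succ]

/-- `t_1 = τ(z)`. [folklore] -/
@[simp]
theorem lambertInstant_one (ξs : ℕ → EuclideanSpace ℝ d) (z : Config N d X) :
    lambertInstant G ε ξs z 1 = freeExitTime G ε z := by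
  simp [lambertInstant_succ]

/-- The collision instants are nondecreasing in `k`. [folklore] -/
theorem monotone_lambertInstant (ξs : ℕ → EuclideanSpace ℝ d) (z : Config N d X) :
    Monotone (lambertInstant G ε ξs z) := by
  refine monotone_nat_of_le_succ fun k => ?_
  rw [lambertInstant_succ]
  exact le_self_add

/-- **Restart of the instants after the first collision**:
`t_{k+1}(z; ξs) = τ(z) + t_k(lambertStep (ξs 0) z; ξs ∘ succ)`. [folklore] -/
theorem lambertInstant_succ_eq_tail (ξs : ℕ → EuclideanSpace ℝ d) (z : Config N d X) (k : ℕ) :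
    lambertInstant G ε ξs z (k + 1) = freeExitTime G ε z +
      lambertInstant G ε (fun m => ξs (m + 1)) (lambertStep G ε (ξs 0) z) k := by
  induction k with
  | zero => simp [lambertInstant_succ]
  | succ k ih =>
    rw [lambertInstant_succ, ih, lambertStateAfter_succ_eq_tail, lambertInstant_succ _ _ k,
      add_assoc]

/-- A collision instant is finite iff all the earlier free flights are finite. [folklore] -/
theorem lambertInstant_ne_top_iff {ξs : ℕ → EuclideanSpace ℝ d} {z : Config N d X} {k : ℕ} :
    lambertInstant G ε ξs z k ≠ ∞ ↔
      ∀ m < k, freeExitTime G ε (lambertStateAfter G ε ξs z m) ≠ ∞ := by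
  rw [lambertInstant, ENNReal.sum_ne_top]
  simp only [Finset.mem_range]

/-- **Conservation of momentum along the Lambertian recursion.** [folklore] -/
theorem configMomentum_lambertStateAfter (ξs : ℕ → EuclideanSpace ℝ d) (z : Config N d X)
    (k : ℕ) : configMomentum (lambertStateAfter G ε ξs z k) = configMomentum z := by
  induction k with
  | zero => rfl
  | succ k ih => rw [lambertStateAfter_succ, configMomentum_lambertStep, ih]

/-- The kinetic energy is nonincreasing along the Lambertian recursion (and conserved off the
null degenerate redraws, `configEnergy_lambertStep`). [folklore] -/
theorem configEnergy_lambertStateAfter_le (ξs : ℕ → EuclideanSpace ℝ d) (z : Config N d X)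
    (k : ℕ) : configEnergy (lambertStateAfter G ε ξs z k) ≤ configEnergy z := by
  induction k with
  | zero => exact le_rfl
  | succ k ih => rw [lambertStateAfter_succ]; exact (configEnergy_lambertStep_le _ _).trans ih

/-- In a regular geometry the Lambertian recursion stays in the hard-sphere domain. [folklore] -/
theorem lambertStateAfter_mem [TopologicalSpace X] (hG : G.IsHardSphereRegular ε)
    (ξs : ℕ → EuclideanSpace ℝ d) {z : Config N d X} (hz : z ∈ hardSphereDomain G N ε) (k : ℕ) :
    lambertStateAfter G ε ξs z k ∈ hardSphereDomain G N ε := by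
  induction k with
  | zero => exact hz
  | succ k ih => rw [lambertStateAfter_succ]; exact lambertStep_mem hG _ ih

/-! ### Counting collisions and the flow -/

/-- If `t_k ≤ u < t_{k+1}` then `k` collisions are counted in `[0, u]` (monotonicity of the
instants only). [folklore] -/
theorem lambertCount_eq_of_segment {ξs : ℕ → EuclideanSpace ℝ d} {z : Config N d X} {u : ℝ}
    {k : ℕ} (h1 : lambertInstant G ε ξs z k ≤ ENNReal.ofReal u)
    (h2 : ENNReal.ofReal u < lambertInstant G ε ξs z (k + 1)) : lambertCount G ε ξs z u = k := by
  have hub : ∀ m ∈ {m : ℕ | lambertInstant G ε ξs z m ≤ ENNReal.ofReal u}, m ≤ k := by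
    intro m hm
    by_contra hmk
    exact (not_le.2 h2)
      ((monotone_lambertInstant ξs z (Nat.succ_le_of_lt (not_le.1 hmk))).trans hm)
  exact le_antisymm (csSup_le' hub) (le_csSup ⟨k, hub⟩ h1)

/-- On the segment `t_k ≤ u < t_{k+1}` the Lambertian flow is `S_{u - t_k} z_k`. [folklore] -/
theorem lambertFlow_eq_of_segment {ξs : ℕ → EuclideanSpace ℝ d} {z : Config N d X} {u : ℝ}
    {k : ℕ} (h1 : lambertInstant G ε ξs z k ≤ ENNReal.ofReal u)
    (h2 : ENNReal.ofReal u < lambertInstant G ε ξs z (k + 1)) :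
    lambertFlow G ε ξs z u =
      freeFlight G (u - (lambertInstant G ε ξs z k).toReal) (lambertStateAfter G ε ξs z k) := by
  rw [lambertFlow, lambertCount_eq_of_segment h1 h2]

/-- Before the first collision no collision is counted: `lambertCount z t = 0` for `t < τ(z)`.
[folklore] -/
theorem lambertCount_eq_zero_of_lt {ξs : ℕ → EuclideanSpace ℝ d} {z : Config N d X} {t : ℝ}
    (h : ENNReal.ofReal t < freeExitTime G ε z) : lambertCount G ε ξs z t = 0 :=
  lambertCount_eq_of_segment (by simp) (by simpa using h)

/-- Before the first collision the Lambertian flow is free flight (whatever the noise):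
`Λ_t z = S_t z` for `t < τ(z)`. [folklore] -/
theorem lambertFlow_eq_freeFlight_of_lt {ξs : ℕ → EuclideanSpace ℝ d} {z : Config N d X} {t : ℝ}
    (h : ENNReal.ofReal t < freeExitTime G ε z) : lambertFlow G ε ξs z t = freeFlight G t z := by
  simp [lambertFlow, lambertCount_eq_zero_of_lt h]

/-- `Λ_0 z = z` as soon as `τ(z) > 0`. [folklore] -/
theorem lambertFlow_zero_of_pos {ξs : ℕ → EuclideanSpace ℝ d} {z : Config N d X}
    (h : 0 < freeExitTime G ε z) : lambertFlow G ε ξs z 0 = z := by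
  rw [lambertFlow_eq_freeFlight_of_lt (by simpa using h), freeFlight_zero]

/-- **Conservation of momentum along the Lambertian flow.** [folklore] -/
theorem configMomentum_lambertFlow (ξs : ℕ → EuclideanSpace ℝ d) (z : Config N d X) (t : ℝ) :
    configMomentum (lambertFlow G ε ξs z t) = configMomentum z := by
  rw [lambertFlow, configMomentum_freeFlight, configMomentum_lambertStateAfter]

/-- The kinetic energy is nonincreasing along the Lambertian flow (conserved off the null
degenerate redraws). [folklore] -/
theorem configEnergy_lambertFlow_le (ξs : ℕ → EuclideanSpace ℝ d) (z : Config N d X) (t : ℝ) :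
    configEnergy (lambertFlow G ε ξs z t) ≤ configEnergy z := by
  rw [lambertFlow, configEnergy_freeFlight]
  exact configEnergy_lambertStateAfter_le _ _ _

/-- Splitting `t` at a finite exit time `τ ≤ t`: `t = τ + (t - τ)` in `ℝ≥0∞` (also for the junk
values at `t < 0`, where both sides vanish). [folklore] -/
theorem ofReal_eq_add_ofReal_sub_toReal {τ : ℝ≥0∞} {t : ℝ} (hτ : τ ≠ ∞)
    (h : τ ≤ ENNReal.ofReal t) : ENNReal.ofReal t = τ + ENNReal.ofReal (t - τ.toReal) := by
  rcases le_or_gt 0 t with ht | ht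
  · have hle : τ.toReal ≤ t := ENNReal.toReal_le_of_le_ofReal ht h
    rw [← ENNReal.ofReal_toReal hτ, ENNReal.toReal_ofReal ENNReal.toReal_nonneg,
      ← ENNReal.ofReal_add ENNReal.toReal_nonneg (sub_nonneg.2 hle), add_sub_cancel]
  · have h0 : ENNReal.ofReal t = 0 := ENNReal.ofReal_of_nonpos ht.le
    rw [h0] at h ⊢
    rw [nonpos_iff_eq_zero.1 h, ENNReal.toReal_zero, sub_zero, h0, zero_add]

/-- **Restart of the collision count after the first collision**: if `τ(z) ≤ t < ∞` and the
instants of `z` eventually exceed `t` (no accumulation before `t`), then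
`K_t(z; ξs) = K_{t - τ(z)}(lambertStep (ξs 0) z; ξs ∘ succ) + 1`. [folklore] -/
theorem lambertCount_eq_lambertCount_lambertStep_succ {ξs : ℕ → EuclideanSpace ℝ d}
    {z : Config N d X} {t : ℝ} (hτ : freeExitTime G ε z ≠ ∞)
    (hτt : freeExitTime G ε z ≤ ENNReal.ofReal t)
    (hacc : ∃ k, ENNReal.ofReal t < lambertInstant G ε ξs z k) :
    lambertCount G ε ξs z t = lambertCount G ε (fun m => ξs (m + 1)) (lambertStep G ε (ξs 0) z)
      (t - (freeExitTime G ε z).toReal) + 1 := by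
  set τ := freeExitTime G ε z with hτ_def
  set t' := t - τ.toReal with ht'
  set ξs' : ℕ → EuclideanSpace ℝ d := fun m => ξs (m + 1) with hξs'
  set z₁ := lambertStep G ε (ξs 0) z with hz₁
  have hsplit : ENNReal.ofReal t = τ + ENNReal.ofReal t' := ofReal_eq_add_ofReal_sub_toReal hτ hτt
  -- the set of the tail recursion is bounded above
  set S' : Set ℕ := {k : ℕ | lambertInstant G ε ξs' z₁ k ≤ ENNReal.ofReal t'} with hS'
  obtain ⟨k₀, hk₀⟩ := hacc
  have hbdd : BddAbove S' := by
    refine ⟨k₀, fun m hm => ?_⟩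
    by_contra hlt
    have hle : lambertInstant G ε ξs z k₀ ≤ lambertInstant G ε ξs z (m + 1) :=
      monotone_lambertInstant ξs z (by omega)
    have hm' : lambertInstant G ε ξs z (m + 1) ≤ ENNReal.ofReal t := by
      rw [lambertInstant_succ_eq_tail, hsplit]
      exact add_le_add le_rfl hm
    exact (not_le.2 hk₀) (hle.trans hm')
  have hne : S'.Nonempty := ⟨0, by simp [hS']⟩
  set K' := lambertCount G ε ξs' z₁ t' with hK'
  have hK'mem : K' ∈ S' := Nat.sSup_mem hne hbdd
  have hK'succ : K' + 1 ∉ S' := fun hmem =>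
    Nat.lt_irrefl _ (Nat.lt_of_succ_le (le_csSup hbdd hmem))
  refine lambertCount_eq_of_segment ?_ ?_
  · rw [lambertInstant_succ_eq_tail, hsplit]
    exact add_le_add le_rfl hK'mem
  · rw [lambertInstant_succ_eq_tail, hsplit]
    exact ENNReal.add_lt_add_left hτ (not_le.1 hK'succ)

/-- **Restart of the flow after the first collision** (the identity behind the
Trotter–Lindeberg telescoping of the routes): if `τ(z) ≤ t`, `τ(z) < ∞` and the instants of `z`
eventually exceed `t`, then `Λ_t(z; ξs) = Λ_{t - τ(z)}(lambertStep (ξs 0) z; ξs ∘ succ)`.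
[folklore] -/
theorem lambertFlow_eq_lambertFlow_lambertStep {ξs : ℕ → EuclideanSpace ℝ d}
    {z : Config N d X} {t : ℝ} (hτ : freeExitTime G ε z ≠ ∞)
    (hτt : freeExitTime G ε z ≤ ENNReal.ofReal t)
    (hacc : ∃ k, ENNReal.ofReal t < lambertInstant G ε ξs z k) :
    lambertFlow G ε ξs z t = lambertFlow G ε (fun m => ξs (m + 1)) (lambertStep G ε (ξs 0) z)
      (t - (freeExitTime G ε z).toReal) := by
  have hK := lambertCount_eq_lambertCount_lambertStep_succ hτ hτt hacc
  set τ := freeExitTime G ε z with hτ_def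
  set t' := t - τ.toReal with ht'
  set ξs' : ℕ → EuclideanSpace ℝ d := fun m => ξs (m + 1) with hξs'
  set z₁ := lambertStep G ε (ξs 0) z with hz₁
  set K' := lambertCount G ε ξs' z₁ t' with hK'
  -- finiteness of the instant reached
  have hsplit : ENNReal.ofReal t = τ + ENNReal.ofReal t' := ofReal_eq_add_ofReal_sub_toReal hτ hτt
  have hfin : lambertInstant G ε ξs' z₁ K' ≠ ∞ := by
    -- `K'` lies in the (bounded) set defining the count, so `t'_{K'} ≤ t' < ∞`
    obtain ⟨k₀, hk₀⟩ := hacc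
    have hbdd : BddAbove {k : ℕ | lambertInstant G ε ξs' z₁ k ≤ ENNReal.ofReal t'} := by
      refine ⟨k₀, fun m hm => ?_⟩
      by_contra hlt
      have hle : lambertInstant G ε ξs z k₀ ≤ lambertInstant G ε ξs z (m + 1) :=
        monotone_lambertInstant ξs z (by omega)
      have hm' : lambertInstant G ε ξs z (m + 1) ≤ ENNReal.ofReal t := by
        rw [lambertInstant_succ_eq_tail, hsplit]
        exact add_le_add le_rfl hm
      exact (not_le.2 hk₀) (hle.trans hm')
    have hmem : K' ∈ {k : ℕ | lambertInstant G ε ξs' z₁ k ≤ ENNReal.ofReal t'} :=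
      Nat.sSup_mem ⟨0, by simp⟩ hbdd
    exact ne_top_of_le_ne_top ENNReal.ofReal_ne_top hmem
  rw [lambertFlow, lambertFlow, hK, lambertStateAfter_succ_eq_tail, lambertInstant_succ_eq_tail,
    ENNReal.toReal_add hτ hfin]
  congr 1
  rw [ht']
  ring

end Flow


/-! ## The noise: shift invariance and the head/tail (Fubini) decomposition -/

section Noise

variable (d : Type*) [Fintype d]

/-- **Shift invariance of the Lambertian noise**: dropping the first Gaussian vector of an
i.i.d. sequence leaves an i.i.d. sequence with the same law. [folklore] -/
theorem lambertNoise_map_tail :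
    (lambertNoise d).map (fun (ξs : ℕ → EuclideanSpace ℝ d) (m : ℕ) => ξs (m + 1)) =
      lambertNoise d :=
  Measure.map_infinitePi_infinitePi_of_inj (P := fun _ : ℕ => stdGaussian (EuclideanSpace ℝ d))
    (f := fun m : ℕ => m + 1) Nat.succ_injective

omit [Fintype d] in
/-- The tail map `ξs ↦ (m ↦ ξs (m+1))` is measurable. [folklore] -/
theorem measurable_tail :
    Measurable fun (ξs : ℕ → EuclideanSpace ℝ d) (m : ℕ) => ξs (m + 1) :=
  measurable_pi_lambda _ fun m => measurable_pi_apply (m + 1)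

/-- **Head and tail of the Lambertian noise are independent** (coordinates of a product
measure over disjoint index sets). [folklore] -/
theorem indepFun_head_tail_lambertNoise :
    IndepFun (fun ξs : ℕ → EuclideanSpace ℝ d => ξs 0)
      (fun (ξs : ℕ → EuclideanSpace ℝ d) (m : ℕ) => ξs (m + 1)) (lambertNoise d) := by
  have hi : iIndepFun (fun (i : ℕ) (ξs : ℕ → EuclideanSpace ℝ d) => ξs i) (lambertNoise d) :=
    iIndepFun_infinitePi (P := fun _ : ℕ => stdGaussian (EuclideanSpace ℝ d))
      (X := fun _ x => x) fun _ => measurable_id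
  rw [iIndepFun_iff_iIndep] at hi
  have hdisj : Disjoint ({0} : Set ℕ) (Set.Ici 1) := by
    rw [Set.disjoint_singleton_left, Set.mem_Ici]
    exact Nat.not_succ_le_zero 0
  have h := indep_iSup_of_disjoint (fun i => (measurable_pi_apply i).comap_le) hi hdisj
  rw [IndepFun_iff_Indep]
  refine indep_of_indep_of_le_right (indep_of_indep_of_le_left h ?_) ?_
  · exact le_iSup₂_of_le (f := fun (i : ℕ) (_ : i ∈ ({0} : Set ℕ)) =>
      MeasurableSpace.comap (fun ξs : ℕ → EuclideanSpace ℝ d => ξs i) inferInstance)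
      0 (Set.mem_singleton 0) le_rfl
  · refine (le_of_eq (MeasurableSpace.comap_process_pi
      (fun (m : ℕ) (ξs : ℕ → EuclideanSpace ℝ d) => ξs (m + 1)))).trans (iSup_le fun m => ?_)
    exact le_iSup₂_of_le (f := fun (i : ℕ) (_ : i ∈ Set.Ici 1) =>
      MeasurableSpace.comap (fun ξs : ℕ → EuclideanSpace ℝ d => ξs i) inferInstance)
      (m + 1) (Set.mem_Ici.2 (Nat.succ_le_succ (Nat.zero_le m))) le_rfl

/-- **Head/tail decomposition of the Lambertian noise** (`γ^ℕ ≅ γ ⊗ γ^ℕ`): the map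
`ξs ↦ (ξs 0, (ξs (m+1))_m)` pushes `lambertNoise` forward to `stdGaussian ⊗ lambertNoise`. This is
the Fubini input of the restart identities (`lambertStateAfter_succ_eq_tail`,
`lambertFlow_eq_lambertFlow_lambertStep`). [folklore] -/
theorem lambertNoise_map_headTail :
    (lambertNoise d).map (fun ξs : ℕ → EuclideanSpace ℝ d => (ξs 0, fun m : ℕ => ξs (m + 1))) =
      (stdGaussian (EuclideanSpace ℝ d)).prod (lambertNoise d) := by
  rw [(indepFun_head_tail_lambertNoise d).map_prod_eq_prod_map_map
    (measurable_pi_apply 0).aemeasurable (measurable_tail d).aemeasurable, lambertNoise_map_tail]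
  congr 1
  exact Measure.infinitePi_map_eval (fun _ : ℕ => stdGaussian (EuclideanSpace ℝ d)) 0

/-- **Fubini over the first redraw**: an integral against the Lambertian noise of a function of
(head, tail) is the iterated integral against `stdGaussian` and `lambertNoise`. [folklore] -/
theorem integral_lambertNoise_headTail {B : Type*} [NormedAddCommGroup B] [NormedSpace ℝ B]
    (H : EuclideanSpace ℝ d × (ℕ → EuclideanSpace ℝ d) → B)
    (hH : AEStronglyMeasurable H ((stdGaussian (EuclideanSpace ℝ d)).prod (lambertNoise d))) :
    ∫ ξs, H (ξs 0, fun m => ξs (m + 1)) ∂(lambertNoise d) =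
      ∫ p, H p ∂((stdGaussian (EuclideanSpace ℝ d)).prod (lambertNoise d)) := by
  rw [← lambertNoise_map_headTail, integral_map
    ((measurable_pi_apply 0).prodMk (measurable_tail d)).aemeasurable]
  rwa [lambertNoise_map_headTail]

end Noise

/-! ## Measurability, jointly in the datum and the noise -/

section Measurability

variable {E : Type*} [NormedAddCommGroup E] [InnerProductSpace ℝ E] [MeasurableSpace E]
  [BorelSpace E] [SecondCountableTopology E]

/-- The Lambertian direction of measurable arguments is measurable (compositional form).
[folklore] -/
theorem _root_.Measurable.lambertDir {α : Type*} [MeasurableSpace α] {f g : α → E}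
    (hf : Measurable f) (hg : Measurable g) : Measurable fun a => lambertDir (f a) (g a) := by
  simp only [lambertDir_def]
  have hn : ∀ {u : α → E}, Measurable u → Measurable fun a => ‖u a‖⁻¹ • u a :=
    fun hu => hu.norm.inv.smul hu
  exact hn ((hn hf).add (hn hg))

/-- The Lambertian direction is jointly measurable in `(ω, ξ)`. [folklore] -/
theorem measurable_lambertDir : Measurable fun p : E × E => lambertDir p.1 p.2 :=
  measurable_fst.lambertDir measurable_snd

end Measurability

section Measurability

variable {d : Type*} [Fintype d] {X : Type*} {N : ℕ} [MeasurableSpace X] {G : Geometry d X}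
  {ε : ℝ}

/-- The Lambertian redraw of a fixed pair is jointly measurable in `(z, ξ)` (measurable
geometry). [folklore] -/
theorem measurable_lambertPair (hGm : G.IsMeasurable) (i j : Fin N) :
    Measurable fun p : Config N d X × EuclideanSpace ℝ d => lambertPair G i j p.1 p.2 := by
  have hvi : Measurable fun p : Config N d X × EuclideanSpace ℝ d => (p.1 i).2 :=
    (Geometry.IsMeasurable.measurable_vel i).comp measurable_fst
  have hvj : Measurable fun p : Config N d X × EuclideanSpace ℝ d => (p.1 j).2 :=
    (Geometry.IsMeasurable.measurable_vel j).comp measurable_fst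
  have hn : Measurable fun p : Config N d X × EuclideanSpace ℝ d => G.sepVec (p.1 i).1 (p.1 j).1 :=
    (hGm.measurable_sepVec_config i j).comp measurable_fst
  have hc : Measurable fun p : Config N d X × EuclideanSpace ℝ d =>
      (2 : ℝ)⁻¹ • ((p.1 i).2 + (p.1 j).2) :=
    (measurable_const_smul ((2 : ℝ)⁻¹)).comp (hvi.fun_add hvj)
  have hr : Measurable fun p : Config N d X × EuclideanSpace ℝ d => ‖(p.1 i).2 - (p.1 j).2‖ / 2 :=
    (hvi.fun_sub hvj).norm.div_const 2
  have hdir : Measurable fun p : Config N d X × EuclideanSpace ℝ d =>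
      lambertDir (G.sepVec (p.1 i).1 (p.1 j).1) p.2 :=
    hn.lambertDir measurable_snd
  have hw : Measurable fun p : Config N d X × EuclideanSpace ℝ d =>
      (‖(p.1 i).2 - (p.1 j).2‖ / 2) • lambertDir (G.sepVec (p.1 i).1 (p.1 j).1) p.2 :=
    hr.fun_smul hdir
  refine measurable_pi_lambda _ fun k => ?_
  by_cases hkj : k = j
  · subst hkj
    simp only [lambertPair_apply_right]
    exact ((Geometry.IsMeasurable.measurable_pos k).comp measurable_fst).prodMk (hc.sub hw)
  by_cases hki : k = i
  · subst hki
    simp only [lambertPair_apply_left hkj]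
    exact ((Geometry.IsMeasurable.measurable_pos k).comp measurable_fst).prodMk (hc.add hw)
  · simp only [lambertPair_apply_of_ne hki hkj]
    exact (measurable_pi_apply k).comp measurable_fst

/-- For a fixed set of pairs, `lambertStepMap G S` is jointly measurable in `(w, ξ)`. [folklore] -/
theorem measurable_lambertStepMap (hGm : G.IsMeasurable) (S : Set (Fin N × Fin N)) :
    Measurable fun p : Config N d X × EuclideanSpace ℝ d => lambertStepMap G S p.1 p.2 := by
  unfold lambertStepMap
  split_ifs with h
  · exact measurable_lambertPair hGm _ _
  · exact measurable_fst

/-- `a ↦ lambertStepMap G (incomingPairs G ε (w a)) (w a) (ξ a)` is measurable for measurable `w`,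
`ξ`: the set of incoming pairs takes finitely many values on measurable level sets. [folklore] -/
theorem measurable_lambertStepMap_incomingPairs {α : Type*} [MeasurableSpace α]
    (hGm : G.IsMeasurable) {w : α → Config N d X} (hw : Measurable w)
    {ξ : α → EuclideanSpace ℝ d} (hξ : Measurable ξ) :
    Measurable fun a => lambertStepMap G (incomingPairs G ε (w a)) (w a) (ξ a) := by
  letI : MeasurableSpace (Set (Fin N × Fin N)) := ⊤
  haveI : MeasurableSingletonClass (Set (Fin N × Fin N)) := ⟨fun _ => trivial⟩
  have hF : Measurable fun p : Set (Fin N × Fin N) × (Config N d X × EuclideanSpace ℝ d) =>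
      lambertStepMap G p.1 p.2.1 p.2.2 :=
    measurable_from_prod_countable_right fun S => measurable_lambertStepMap hGm S
  have hS : Measurable fun a => incomingPairs G ε (w a) := by
    refine measurable_to_countable' fun S => ?_
    have hset : (fun a => incomingPairs G ε (w a)) ⁻¹' {S} =
        ⋂ p : Fin N × Fin N, {a | p ∈ incomingPairs G ε (w a) ↔ p ∈ S} := by
      ext a
      simp only [mem_preimage, mem_singleton_iff, mem_iInter, mem_setOf_eq, Set.ext_iff]
    rw [hset]
    refine MeasurableSet.iInter fun p => measurableSet_setOf.2 ?_
    exact (measurableSet_setOf.1 ((measurableSet_mem_incomingPairs hGm p).preimage hw)).iff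
      measurable_const
  exact hF.comp (hS.prodMk (hw.prodMk hξ))

variable [TopologicalSpace X]

/-- **The Lambertian step of measurable arguments is measurable** (regular and measurable
geometry; compositional form). [folklore] -/
theorem measurable_lambertStep_comp {α : Type*} [MeasurableSpace α] (hG : G.IsHardSphereRegular ε)
    (hGm : G.IsMeasurable) {w : α → Config N d X} (hw : Measurable w)
    {ξ : α → EuclideanSpace ℝ d} (hξ : Measurable ξ) :
    Measurable fun a => lambertStep G ε (ξ a) (w a) := by
  have hτ : Measurable fun a => freeExitTime G ε (w a) := (measurable_freeExitTime hG hGm).comp hw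
  have hz' : Measurable fun a => freeFlight G (freeExitTime G ε (w a)).toReal (w a) :=
    hGm.measurable_freeFlight₂.comp (hτ.ennreal_toReal.prodMk hw)
  have h : (fun a => lambertStep G ε (ξ a) (w a)) = fun a =>
      if freeExitTime G ε (w a) = ∞ then w a else
        lambertStepMap G (incomingPairs G ε (freeFlight G (freeExitTime G ε (w a)).toReal (w a)))
          (freeFlight G (freeExitTime G ε (w a)).toReal (w a)) (ξ a) :=
    funext fun a => lambertStep_eq (ξ a) (w a)
  rw [h]
  exact Measurable.ite (hτ (measurableSet_singleton ∞)) hw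
    (measurable_lambertStepMap_incomingPairs hGm hz' hξ)

/-- **The Lambertian step is jointly measurable in `(z, ξ)`** (regular and measurable geometry).
[folklore] -/
theorem measurable_lambertStep (hG : G.IsHardSphereRegular ε) (hGm : G.IsMeasurable) :
    Measurable fun p : Config N d X × EuclideanSpace ℝ d => lambertStep G ε p.2 p.1 :=
  measurable_lambertStep_comp hG hGm measurable_fst measurable_snd

/-- **The `k`-th state of the Lambertian recursion is jointly measurable in `(z, ξs)`.**
[folklore] -/
theorem measurable_lambertStateAfter (hG : G.IsHardSphereRegular ε) (hGm : G.IsMeasurable) (k : ℕ) :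
    Measurable fun p : Config N d X × (ℕ → EuclideanSpace ℝ d) => lambertStateAfter G ε p.2 p.1 k := by
  induction k with
  | zero => exact measurable_fst
  | succ k ih =>
    have h : (fun p : Config N d X × (ℕ → EuclideanSpace ℝ d) => lambertStateAfter G ε p.2 p.1 (k + 1)) =
        fun p => lambertStep G ε (p.2 k) (lambertStateAfter G ε p.2 p.1 k) :=
      funext fun p => lambertStateAfter_succ p.2 p.1 k
    rw [h]
    exact measurable_lambertStep_comp hG hGm ih ((measurable_pi_apply k).comp measurable_snd)

/-- The `k`-th instant of the Lambertian recursion is jointly measurable in `(z, ξs)`. [folklore] -/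
theorem measurable_lambertInstant (hG : G.IsHardSphereRegular ε) (hGm : G.IsMeasurable) (k : ℕ) :
    Measurable fun p : Config N d X × (ℕ → EuclideanSpace ℝ d) => lambertInstant G ε p.2 p.1 k := by
  induction k with
  | zero => simp only [lambertInstant_zero, measurable_const]
  | succ k ih =>
    simp only [lambertInstant_succ]
    exact ih.add ((measurable_freeExitTime hG hGm).comp (measurable_lambertStateAfter hG hGm k))

/-- The number of collisions of the Lambertian recursion in `[0, t]` is jointly measurable in
`(z, ξs)`. [folklore] -/
theorem measurable_lambertCount (hG : G.IsHardSphereRegular ε) (hGm : G.IsMeasurable) (t : ℝ) :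
    Measurable fun p : Config N d X × (ℕ → EuclideanSpace ℝ d) => lambertCount G ε p.2 p.1 t := by
  refine measurable_to_countable' fun k => ?_
  have hA : ∀ m, MeasurableSet {p : Config N d X × (ℕ → EuclideanSpace ℝ d) |
      lambertInstant G ε p.2 p.1 m ≤ ENNReal.ofReal t} :=
    fun m => measurableSet_le (measurable_lambertInstant hG hGm m) measurable_const
  have hset : (fun p : Config N d X × (ℕ → EuclideanSpace ℝ d) => lambertCount G ε p.2 p.1 t) ⁻¹' {k} =
      {p | (lambertInstant G ε p.2 p.1 k ≤ ENNReal.ofReal t ∧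
        ¬lambertInstant G ε p.2 p.1 (k + 1) ≤ ENNReal.ofReal t) ∨
        (k = 0 ∧ ∀ m, lambertInstant G ε p.2 p.1 m ≤ ENNReal.ofReal t)} := by
    ext p
    simp only [mem_preimage, mem_singleton_iff, mem_setOf_eq]
    exact Nat.sSup_eq_iff_of_lowerSet
      (S := {m | lambertInstant G ε p.2 p.1 m ≤ ENNReal.ofReal t}) (by simp)
      (fun m n hmn hn => (monotone_lambertInstant p.2 p.1 hmn).trans hn) k
  rw [hset]
  refine measurableSet_setOf.2 ((((measurableSet_setOf.1 (hA k)).and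
    (measurableSet_setOf.1 (hA (k + 1))).not)).or (measurable_const.and
      (Measurable.forall fun m => measurableSet_setOf.1 (hA m))))

/-- **Each time-`t` map of the Lambertian flow is jointly measurable in `(z, ξs)`** (regular and
measurable geometry). [folklore] -/
theorem measurable_lambertFlow (hG : G.IsHardSphereRegular ε) (hGm : G.IsMeasurable) (t : ℝ) :
    Measurable fun p : Config N d X × (ℕ → EuclideanSpace ℝ d) => lambertFlow G ε p.2 p.1 t := by
  have hF : Measurable fun q : ℕ × (Config N d X × (ℕ → EuclideanSpace ℝ d)) =>
      freeFlight G (t - (lambertInstant G ε q.2.2 q.2.1 q.1).toReal)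
        (lambertStateAfter G ε q.2.2 q.2.1 q.1) :=
    measurable_from_prod_countable_right fun k => hGm.measurable_freeFlight₂.comp
      ((measurable_const.sub (measurable_lambertInstant hG hGm k).ennreal_toReal).prodMk
        (measurable_lambertStateAfter hG hGm k))
  have h : (fun p : Config N d X × (ℕ → EuclideanSpace ℝ d) => lambertFlow G ε p.2 p.1 t) =
      (fun q : ℕ × (Config N d X × (ℕ → EuclideanSpace ℝ d)) =>
        freeFlight G (t - (lambertInstant G ε q.2.2 q.2.1 q.1).toReal)
          (lambertStateAfter G ε q.2.2 q.2.1 q.1)) ∘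
        fun p => (lambertCount G ε p.2 p.1 t, p) :=
    funext fun p => rfl
  rw [h]
  exact hF.comp ((measurable_lambertCount hG hGm t).prodMk measurable_id)

/-- For a fixed noise sequence, each time-`t` map `z ↦ Λ_t(z, ξs)` is measurable. [folklore] -/
theorem measurable_lambertFlow_left (hG : G.IsHardSphereRegular ε) (hGm : G.IsMeasurable)
    (ξs : ℕ → EuclideanSpace ℝ d) (t : ℝ) :
    Measurable fun z : Config N d X => lambertFlow G ε ξs z t := by
  have h : (fun z : Config N d X => lambertFlow G ε ξs z t) =
      (fun p : Config N d X × (ℕ → EuclideanSpace ℝ d) => lambertFlow G ε p.2 p.1 t) ∘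
        fun z => (z, ξs) :=
    funext fun z => rfl
  rw [h]
  exact (measurable_lambertFlow hG hGm t).comp (measurable_id.prodMk measurable_const)

/-- For a fixed datum, each time-`t` map `ξs ↦ Λ_t(z, ξs)` is measurable. [folklore] -/
theorem measurable_lambertFlow_right (hG : G.IsHardSphereRegular ε) (hGm : G.IsMeasurable)
    (z : Config N d X) (t : ℝ) :
    Measurable fun ξs : ℕ → EuclideanSpace ℝ d => lambertFlow G ε ξs z t := by
  have h : (fun ξs : ℕ → EuclideanSpace ℝ d => lambertFlow G ε ξs z t) =
      (fun p : Config N d X × (ℕ → EuclideanSpace ℝ d) => lambertFlow G ε p.2 p.1 t) ∘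
        fun ξs => (z, ξs) :=
    funext fun ξs => rfl
  rw [h]
  exact (measurable_lambertFlow hG hGm t).comp (measurable_const.prodMk measurable_id)

end Measurability

/-! ## The torus, and the fixed-reduced-density scaling of the hydrodynamic limit -/

section Torus

variable {d : Type*} [Fintype d] {N : ℕ}

/-- **Measurability of the Lambertian flow on `T^d`**, `ε < 1/2`, jointly in `(z, ξs)`. [folklore] -/
theorem measurable_lambertFlow_torus {ε : ℝ} (hε : ε < 2⁻¹) (t : ℝ) :
    Measurable fun p : Config N d (UnitAddTorus d) × (ℕ → EuclideanSpace ℝ d) =>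
      lambertFlow (Torus.geometry d) ε p.2 p.1 t :=
  measurable_lambertFlow (Torus.isHardSphereRegular_geometry hε) Torus.isMeasurable_geometry t

/-- **Measurability of the Lambertian flow of `N + 1` spheres of diameter `hsDiameter σ N` on
`𝕋³`** for `0 ≤ σ < 1/2`, jointly in `(z, ξs)` — clause (a) of the route item
`LambertianWellPosed` of `SpecularLambertianSwap`. [folklore] -/
theorem measurable_lambertFlow_hsDiameter {σ : ℝ} (hσ : 0 ≤ σ) (hσ' : σ < 2⁻¹) (N : ℕ) (t : ℝ) :
    Measurable fun p : Config (N + 1) (Fin 3) (UnitAddTorus (Fin 3)) × (ℕ → EuclideanSpace ℝ (Fin 3)) =>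
      lambertFlow (Torus.geometry (Fin 3)) (hsDiameter σ N) p.2 p.1 t :=
  measurable_lambertFlow_torus ((hsDiameter_le hσ N).trans_lt hσ') t

end Torus

end Literature.MathematicalPhysics.KineticTheory
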